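import Mathlib
import Literature.NumberTheory.LFunctions.Zhang2022.TypedSection10C
import Literature.NumberTheory.LFunctions.Zhang2022.Section8LambdaZeroGlobal
import Literature.NumberTheory.LFunctions.Zhang2022.Section8TotientLogMean
import Literature.NumberTheory.LFunctions.Zhang2022.Section10cGather1422
import Literature.NumberTheory.LFunctions.Zhang2022.Section10cSumIntegralEngine
import HarnessLib

/-!
# Zhang (2022) §10: "the results in Section 8" as ONE evaluation rule for the weights
# `|χ(n)|λ₀ⱼ(n)/φ(n)` — `Σ_{P^a≤n<P^b}|χ(n)|λ₀ⱼ(n)φ(n)⁻¹G(n) = c_D∫_{P^a}^{P^b}G(t)dt/t + O(𝓛²‖G‖)`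

Topic `Literature/NumberTheory/LFunctions/Zhang2022` (Landau–Siegel audit tree; verdict-neutral).
Y. Zhang, *Discrete mean estimates and the Landau–Siegel zero*, arXiv:2211.02515v1 (2022)
[Zhang2022LandauSiegel], §8 p. 48 (the three "results in Section 8" quoted by §10 pp. 57–61:
`λ₀ⱼ(n) = φ(n)²/n² + O(α₁)`, `Σ_{n<x}|χ(n)|φ(n)/n² = (6/π²)∏_{q∣D}q/(q+1)·log x + O(…)`, "partial
integration") — **an unrefereed manuscript under adjudication; nothing here bears on its
Theorems 1–2.** D-0069 campaign, discharge layer L3 (seat sz-d34).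

`lamAvg_rule` (THEOREM, no hypotheses beyond largeness of `D`): there is `C₀` such that for all
large `D`, every real primitive `χ (mod D)`, every index `j`, every window `1 ≤ lo ≤ hi ≤ P − 1` and
every profile `G` differentiable on `[lo, hi + 1]` with `‖G‖ ≤ M`, `‖G′(t)‖ ≤ M′/t`,
`‖Typed.Sec10C.lamAvg c′ χ j lo hi G − c_D∫_{lo}^{hi}G(t)dt/t‖ ≤ C₀𝓛²(M + M′log P)`,
`c_D = (6/π²)∏_{q∣D}q/(q+1)` (and `c_D·L′(1,χ)² = 𝔞`, `Lemma171.frakAC_eq`). Inputs, all tree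
theorems: d16's `Section8cProofs.norm_lamZero_sub_totient_sq_le_rel` (relative `λ₀ⱼ` estimate) and
`Section8cProofs.step8u048_weak` (the mean value, from `Sieve.CoprimeTotient`), and the
partial-summation engine `SumIntegralRule.norm_sum_weight_sub_integral_le`. This is the common
content of the §10c nodes `Mid1422Int`, `Top1422Int`, `Low1214X`, `Mid1214Int`, `Top1214Int`.

## References

* Y. Zhang, arXiv:2211.02515v1 (2022), §8 p. 48; §10 pp. 57–61. [cite: Zhang2022LandauSiegel, §8 p. 48]
-/

noncomputable section

open Complex Real ComplexConjugate
open Literature.NumberTheory.LFunctions.Zhang2022.Skeleton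
open Literature.NumberTheory.LFunctions.Zhang2022.SumIntegralRule

namespace Literature.NumberTheory.LFunctions.Zhang2022.Typed.Sec10C

section Rule

/-- From a derivative bound `‖G′(t)‖ ≤ M′/t` on `[lo, T]` (`lo > 0`) to the Lipschitz form
`‖G(x) − G(y)‖ ≤ M′(y − x)/x` used by `norm_sum_weight_sub_integral_le`. [folklore] -/
private theorem lip_of_deriv_bound {G : ℝ → ℂ} {lo T M' : ℝ} (hlo : 0 < lo)
    (hG : ∀ t, lo ≤ t → t ≤ T → DifferentiableAt ℝ G t ∧ ‖deriv G t‖ ≤ M' / t)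
    {x y : ℝ} (hx : lo ≤ x) (hxy : x ≤ y) (hy : y ≤ T) :
    ‖G x - G y‖ ≤ M' * (y - x) / x := by
  have hx0 : 0 < x := lt_of_lt_of_le hlo hx
  have hM' : 0 ≤ M' := by
    have h := (hG x hx (hxy.trans hy)).2
    have : 0 ≤ M' / x := le_trans (norm_nonneg _) h
    exact (div_nonneg_iff.mp this).elim (fun h => h.1) fun h => absurd h.2 (not_le.mpr hx0)
  have key := Convex.norm_image_sub_le_of_norm_deriv_le (f := G) (s := Set.Icc x y) (C := M' / x)
    (fun t ht => (hG t (le_trans hx ht.1) (le_trans ht.2 hy)).1)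
    (fun t ht => ((hG t (le_trans hx ht.1) (le_trans ht.2 hy)).2).trans
      (div_le_div_of_nonneg_left hM' hx0 ht.1))
    (convex_Icc x y) (Set.left_mem_Icc.mpr hxy) (Set.right_mem_Icc.mpr hxy)
  rw [norm_sub_rev] at key
  calc ‖G x - G y‖ ≤ M' / x * ‖y - x‖ := key
    _ = M' * (y - x) / x := by rw [Real.norm_of_nonneg (by linarith)]; ring

/-- Eventually `𝓛 ≥ 6` and `|c′|α𝓛 ≤ 1` (the standing largeness used by the tree's `λ₀ⱼ` lemma).
[cite: Zhang2022LandauSiegel, §2 (2.1), (2.10)] -/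
theorem forAllLarge_ell_six (c' : ℝ) :
    ForAllLarge fun D _ _ => 6 ≤ ell D ∧ |c'| * alpha D * ell D ≤ 1 := by
  refine ⟨⌈Real.exp (max 6 (|c'| * π + 1))⌉₊, fun D _ χ hD _ _ => ?_⟩
  have hexp : Real.exp (max 6 (|c'| * π + 1)) ≤ D := le_trans (Nat.le_ceil _) (by exact_mod_cast hD)
  have hD0 : (0 : ℝ) < D := lt_of_lt_of_le (Real.exp_pos _) hexp
  have hℓ : max 6 (|c'| * π + 1) ≤ ell D := by
    rw [ell]; exact (Real.le_log_iff_exp_le hD0).mpr hexp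
  have h6 : 6 ≤ ell D := le_trans (le_max_left _ _) hℓ
  have hc : |c'| * π + 1 ≤ ell D := le_trans (le_max_right _ _) hℓ
  refine ⟨h6, ?_⟩
  have hℓ0 : 0 < ell D := by linarith
  rw [mul_assoc, alpha_mul_ell hℓ0, ← mul_div_assoc, div_le_one (by positivity)]
  calc |c'| * π ≤ ell D := by linarith
    _ = ell D ^ 1 := (pow_one _).symm
    _ ≤ ell D ^ 8 := pow_le_pow_right₀ (by linarith) (by norm_num)

/-- Step 1 of the evaluation rule, per term: replacing `λ₀ⱼ(n)/φ(n)` by `φ(n)/n²` in one summand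
costs `≤ 589680·α𝓛·M·|χ(n)|φ(n)/n²`. [cite: Zhang2022LandauSiegel, §8 p. 48] -/
theorem norm_lamTerm_sub_le (c' : ℝ) {D : ℕ} (χ : DirichletCharacter ℂ D) (j : ℕ)
    (hcαℓ : |c'| * alpha D * ell D ≤ 1) (hℓ6 : 6 ≤ ell D) {n : ℕ} (hn1 : 1 ≤ n)
    (hnP : (n : ℝ) < bigP D) {z : ℂ} {M : ℝ} (hz : ‖z‖ ≤ M) :
    ‖(‖χ (n : ZMod D)‖ : ℂ) * lamZero c' D j n / (Nat.totient n : ℂ) * z -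
        ((‖χ (n : ZMod D)‖ * (Nat.totient n : ℝ) / (n : ℝ) ^ 2 : ℝ) : ℂ) * z‖ ≤
      589680 * (alpha D * ell D) * M * (‖χ (n : ZMod D)‖ * (Nat.totient n : ℝ) / (n : ℝ) ^ 2) := by
  have hn0 : (0 : ℝ) < n := by exact_mod_cast hn1
  have hφ0 : (0 : ℝ) < Nat.totient n := by exact_mod_cast Nat.totient_pos.mpr (by omega)
  have hrel := Section8cProofs.norm_lamZero_sub_totient_sq_le_rel hcαℓ hℓ6 hn1 hnP j
  have hφ : (Nat.totient n : ℂ) ≠ 0 := by exact_mod_cast hφ0.ne'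
  have hnC : (n : ℂ) ≠ 0 := by exact_mod_cast hn0.ne'
  have e : (‖χ (n : ZMod D)‖ : ℂ) * lamZero c' D j n / (Nat.totient n : ℂ) * z -
      ((‖χ (n : ZMod D)‖ * (Nat.totient n : ℝ) / (n : ℝ) ^ 2 : ℝ) : ℂ) * z =
      (‖χ (n : ZMod D)‖ : ℂ) * ((lamZero c' D j n - ((Nat.totient n : ℂ) / (n : ℂ)) ^ 2) /
        (Nat.totient n : ℂ)) * z := by
    push_cast
    field_simp
  rw [e, norm_mul, norm_mul, norm_div, Complex.norm_real, norm_norm, Complex.norm_natCast]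
  have hχ0 : 0 ≤ ‖χ (n : ZMod D)‖ := norm_nonneg _
  have hαℓ0 : 0 ≤ alpha D * ell D := by
    have : 0 ≤ ell D := by linarith
    have hα : 0 ≤ alpha D := by rw [alpha, bigP, Real.log_exp]; positivity
    positivity
  have hb0 : 0 ≤ ‖χ (n : ZMod D)‖ * (589680 * (alpha D * ell D) * ((Nat.totient n : ℝ) / n) ^ 2 /
      (Nat.totient n : ℝ)) := by positivity
  calc ‖χ (n : ZMod D)‖ * (‖lamZero c' D j n - ((Nat.totient n : ℂ) / (n : ℂ)) ^ 2‖ /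
        (Nat.totient n : ℝ)) * ‖z‖
      ≤ ‖χ (n : ZMod D)‖ * (589680 * (alpha D * ell D) * ((Nat.totient n : ℝ) / n) ^ 2 /
          (Nat.totient n : ℝ)) * M := by
        gcongr
    _ = 589680 * (alpha D * ell D) * M * (‖χ (n : ZMod D)‖ * (Nat.totient n : ℝ) / (n : ℝ) ^ 2) := by
        field_simp

/-- Step 1 of the evaluation rule, summed: `‖Σ|χ|λ₀ⱼ/φ·G − Σ|χ|φ/n²·G‖ ≤ 589680·α𝓛·M·Σ_{n<⌈hi⌉}|χ|φ/n²`.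
[cite: Zhang2022LandauSiegel, §8 p. 48] -/
theorem norm_lamAvg_sub_wsum_le (c' : ℝ) {D : ℕ} [NeZero D] (χ : DirichletCharacter ℂ D) (j : ℕ)
    (hcαℓ : |c'| * alpha D * ell D ≤ 1) (hℓ6 : 6 ≤ ell D) {lo hi M : ℝ} (hlo0 : 0 < lo)
    (hhiP : (⌈hi⌉₊ : ℝ) ≤ bigP D) (hM0 : 0 ≤ M) {G : ℝ → ℂ}
    (hG : ∀ n : ℕ, ⌈lo⌉₊ ≤ n → n < ⌈hi⌉₊ → ‖G n‖ ≤ M) :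
    ‖lamAvg c' χ j lo hi (fun n => G n) -
        ∑ n ∈ Finset.Ico ⌈lo⌉₊ ⌈hi⌉₊,
          ((‖χ (n : ZMod D)‖ * (Nat.totient n : ℝ) / (n : ℝ) ^ 2 : ℝ) : ℂ) * G n‖ ≤
      589680 * (alpha D * ell D) * M *
        ∑ n ∈ Finset.Ico 1 ⌈hi⌉₊, ‖χ (n : ZMod D)‖ * (Nat.totient n : ℝ) / (n : ℝ) ^ 2 := by
  unfold lamAvg
  rw [← Finset.sum_sub_distrib]
  refine (norm_sum_le _ _).trans ?_
  have hsub : Finset.Ico ⌈lo⌉₊ ⌈hi⌉₊ ⊆ Finset.Ico 1 ⌈hi⌉₊ :=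
    Finset.Ico_subset_Ico (Nat.one_le_ceil_iff.mpr hlo0) le_rfl
  have hα0 : 0 ≤ alpha D * ell D := by
    have : 0 ≤ ell D := by linarith
    have hα : 0 ≤ alpha D := by rw [alpha, bigP, Real.log_exp]; positivity
    positivity
  calc ∑ n ∈ Finset.Ico ⌈lo⌉₊ ⌈hi⌉₊,
        ‖(‖χ (n : ZMod D)‖ : ℂ) * lamZero c' D j n / (Nat.totient n : ℂ) * G n -
          ((‖χ (n : ZMod D)‖ * (Nat.totient n : ℝ) / (n : ℝ) ^ 2 : ℝ) : ℂ) * G n‖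
      ≤ ∑ n ∈ Finset.Ico ⌈lo⌉₊ ⌈hi⌉₊, 589680 * (alpha D * ell D) * M *
          (‖χ (n : ZMod D)‖ * (Nat.totient n : ℝ) / (n : ℝ) ^ 2) := by
        refine Finset.sum_le_sum fun n hn => ?_
        obtain ⟨hn1, hn2⟩ := Finset.mem_Ico.mp hn
        have hn1' : 1 ≤ n := le_trans (Nat.one_le_ceil_iff.mpr hlo0) hn1
        have hnP : (n : ℝ) < bigP D := lt_of_lt_of_le (by exact_mod_cast hn2) hhiP
        exact norm_lamTerm_sub_le c' χ j hcαℓ hℓ6 hn1' hnP (hG n hn1 hn2)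
    _ = 589680 * (alpha D * ell D) * M * ∑ n ∈ Finset.Ico ⌈lo⌉₊ ⌈hi⌉₊,
          ‖χ (n : ZMod D)‖ * (Nat.totient n : ℝ) / (n : ℝ) ^ 2 := by rw [Finset.mul_sum]
    _ ≤ 589680 * (alpha D * ell D) * M * ∑ n ∈ Finset.Ico 1 ⌈hi⌉₊,
          ‖χ (n : ZMod D)‖ * (Nat.totient n : ℝ) / (n : ℝ) ^ 2 :=
        mul_le_mul_of_nonneg_left
          (Finset.sum_le_sum_of_subset_of_nonneg hsub fun n _ _ => by positivity) (by positivity)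

/-- The arithmetic of the final error bound of `lamAvg_rule`. [folklore] -/
private theorem rule_arith {ℓ Λ α M M' C cD lo lhl S : ℝ} (hℓ6 : 6 ≤ ℓ) (hΛ : Λ = ℓ ^ 9)
    (hαℓ : α * ℓ = π / ℓ ^ 8) (hM0 : 0 ≤ M) (hM'0 : 0 ≤ M') (hcD0 : 0 ≤ cD) (hcD1 : cD ≤ 1)
    (hlo : 1 ≤ lo) (hlhl : lhl ≤ Λ) (hlhl0 : 0 ≤ lhl) (hS : S ≤ Λ + |C| * ℓ ^ 2) :
    589680 * (α * ℓ) * M * S +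
        (|C| * ℓ ^ 2 * (2 * M + 2 * M' * lhl) + |cD| * (2 * M' + 2 * M) / lo) ≤
      (2 * |C| + 4 + 589680 * π * (1 + |C|)) * ℓ ^ 2 * (M + M' * Λ) := by
  have hℓ1 : 1 ≤ ℓ := by linarith
  have hℓ2 : 1 ≤ ℓ ^ 2 := one_le_pow₀ hℓ1
  have hℓ8 : 0 < ℓ ^ 8 := by positivity
  have hΛ1 : 1 ≤ Λ := by rw [hΛ]; exact one_le_pow₀ hℓ1
  -- first term
  have t1 : 589680 * (α * ℓ) * M * S ≤ 589680 * π * (1 + |C|) * ℓ ^ 2 * M := by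
    rw [hαℓ]
    have key : π / ℓ ^ 8 * S ≤ π * (1 + |C|) * ℓ ^ 2 := by
      rw [div_mul_eq_mul_div, div_le_iff₀ hℓ8]
      have h9 : ℓ ^ 9 ≤ ℓ ^ 2 * ℓ ^ 8 := by
        rw [← pow_add]; exact pow_le_pow_right₀ hℓ1 (by norm_num)
      have h2 : ℓ ^ 2 ≤ ℓ ^ 2 * ℓ ^ 8 := by
        calc ℓ ^ 2 = ℓ ^ 2 * 1 := (mul_one _).symm
          _ ≤ ℓ ^ 2 * ℓ ^ 8 := by gcongr; exact one_le_pow₀ hℓ1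
      calc π * S ≤ π * (ℓ ^ 9 + |C| * ℓ ^ 2) := by rw [← hΛ]; gcongr
        _ ≤ π * (ℓ ^ 2 * ℓ ^ 8 + |C| * (ℓ ^ 2 * ℓ ^ 8)) := by gcongr
        _ = π * (1 + |C|) * ℓ ^ 2 * ℓ ^ 8 := by ring
    calc 589680 * (π / ℓ ^ 8) * M * S = 589680 * M * (π / ℓ ^ 8 * S) := by ring
      _ ≤ 589680 * M * (π * (1 + |C|) * ℓ ^ 2) := by gcongr
      _ = 589680 * π * (1 + |C|) * ℓ ^ 2 * M := by ring
  -- second term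
  have t2 : |C| * ℓ ^ 2 * (2 * M + 2 * M' * lhl) ≤ 2 * |C| * ℓ ^ 2 * (M + M' * Λ) := by
    have : 2 * M + 2 * M' * lhl ≤ 2 * (M + M' * Λ) := by nlinarith
    calc |C| * ℓ ^ 2 * (2 * M + 2 * M' * lhl) ≤ |C| * ℓ ^ 2 * (2 * (M + M' * Λ)) := by gcongr
      _ = 2 * |C| * ℓ ^ 2 * (M + M' * Λ) := by ring
  -- third term
  have t3 : |cD| * (2 * M' + 2 * M) / lo ≤ 4 * ℓ ^ 2 * (M + M' * Λ) := by
    rw [abs_of_nonneg hcD0]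
    have h1 : cD * (2 * M' + 2 * M) / lo ≤ 2 * M' + 2 * M := by
      rw [div_le_iff₀ (by linarith)]
      have : cD * (2 * M' + 2 * M) ≤ 1 * (2 * M' + 2 * M) :=
        mul_le_mul_of_nonneg_right hcD1 (by positivity)
      nlinarith
    have h2 : M' ≤ M' * Λ := le_mul_of_one_le_right hM'0 hΛ1
    have h3 : 2 * M' + 2 * M ≤ 4 * (M + M' * Λ) := by linarith
    have h4 : 4 * (M + M' * Λ) ≤ 4 * ℓ ^ 2 * (M + M' * Λ) := by
      have : 0 ≤ M + M' * Λ := by positivity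
      nlinarith
    linarith
  have t4 : 589680 * π * (1 + |C|) * ℓ ^ 2 * M ≤
      589680 * π * (1 + |C|) * ℓ ^ 2 * (M + M' * Λ) := by
    have : M ≤ M + M' * Λ := by nlinarith
    gcongr
  linarith

/-- **The §8/§10 evaluation rule for the weights `|χ(n)|λ₀ⱼ(n)/φ(n)`** ("the results in Section 8",
p. 48: `λ₀ⱼ(n) = φ(n)²/n² + O(α₁)`, `Σ_{n<x}|χ(n)|φ(n)/n² = c_D log x + O(…)`, partial integration):
for all large `D`, every real primitive `χ (mod D)`, every `j`, every window `1 ≤ lo ≤ hi ≤ P − 1` and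
every `C¹` profile `G` with `‖G‖ ≤ M`, `‖G′(t)‖ ≤ M′/t` on `[lo, hi + 1]`,
`‖Σ_{lo≤n<hi} |χ(n)|λ₀ⱼ(n)φ(n)⁻¹G(n) − c_D∫_{lo}^{hi}G(t)dt/t‖ ≤ C₀𝓛²(M + M′log P)`,
`c_D = (6/π²)∏_{q∣D} q/(q+1)` (so that `c_D L′(1,χ)² = 𝔞`). Inputs (all tree theorems): the relative
`λ₀ⱼ` estimate `Section8cProofs.norm_lamZero_sub_totient_sq_le_rel` (d16), the mean value
`Section8cProofs.step8u048_weak` (d16, from `Sieve.CoprimeTotient`), and the Abel/Riemann/endpoint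
steps above. [cite: Zhang2022LandauSiegel, §8 p. 48] -/
theorem lamAvg_rule (c' : ℝ) : ∃ C₀ : ℝ, 0 ≤ C₀ ∧ ForAllLarge fun D _ χ =>
    ∀ (j : ℕ) (lo hi M M' : ℝ) (G : ℝ → ℂ), 1 ≤ lo → lo ≤ hi → hi + 1 ≤ bigP D → 0 ≤ M →
      (∀ t, lo ≤ t → t ≤ hi + 1 → DifferentiableAt ℝ G t ∧ ‖G t‖ ≤ M ∧ ‖deriv G t‖ ≤ M' / t) →
      ‖lamAvg c' χ j lo hi (fun n => G n) -
          (((6 / π ^ 2 * ∏ q ∈ D.primeFactors, ((q : ℝ) / (q + 1)) : ℝ)) : ℂ) *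
            ∫ t in lo..hi, G t / t‖ ≤
        C₀ * ell D ^ 2 * (M + M' * Real.log (bigP D)) := by
  obtain ⟨C, hC⟩ := Section8cProofs.step8u048_weak
  refine ⟨2 * |C| + 4 + 589680 * π * (1 + |C|), by positivity, ?_⟩
  refine (hC.and (forAllLarge_ell_six c')).mono ?_
  intro D _ χ _ _ ⟨hA, hℓ6, hcαℓ⟩ j lo hi M M' G hlo hlh hhiP hM0 hG
  have hlo0 : 0 < lo := by linarith
  have hℓ1 : 1 ≤ ell D := by linarith
  have hℓ0 : 0 < ell D := by linarith
  have hΛ : Real.log (bigP D) = ell D ^ 9 := by rw [bigP, Real.log_exp]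
  -- the constant `c_D`
  set cD : ℝ := 6 / π ^ 2 * ∏ q ∈ D.primeFactors, ((q : ℝ) / (q + 1)) with hcD
  have hcD0 : 0 ≤ cD := by
    rw [hcD]; exact mul_nonneg (by positivity) (Finset.prod_nonneg fun q _ => by positivity)
  have hcD1 : cD ≤ 1 := by
    rw [hcD]
    have hprod : ∏ q ∈ D.primeFactors, ((q : ℝ) / (q + 1)) ≤ 1 :=
      Finset.prod_le_one (fun q _ => by positivity) fun q _ => by
        rw [div_le_one (by positivity)]; linarith
    have hπ : 6 / π ^ 2 ≤ 1 := by
      rw [div_le_one (by positivity)]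
      have := Real.pi_gt_three
      nlinarith
    calc 6 / π ^ 2 * ∏ q ∈ D.primeFactors, ((q : ℝ) / (q + 1)) ≤ 1 * 1 :=
          mul_le_mul hπ hprod (Finset.prod_nonneg fun q _ => by positivity) zero_le_one
      _ = 1 := one_mul _
  -- `M' ≥ 0` (from the derivative bound at `lo`)
  have hM'0 : 0 ≤ M' := by
    have h := (hG lo le_rfl (by linarith)).2.2
    have : 0 ≤ M' / lo := le_trans (norm_nonneg _) h
    exact (div_nonneg_iff.mp this).elim (fun h => h.1) fun h => absurd h.2 (not_le.mpr hlo0)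
  -- the counting function
  have hceil : (⌈hi⌉₊ : ℝ) < hi + 1 := Nat.ceil_lt_add_one (by linarith)
  have hAw : ∀ N : ℕ, 1 ≤ N → N ≤ ⌈hi⌉₊ →
      |(∑ n ∈ Finset.Ico 1 N, ‖χ (n : ZMod D)‖ * (Nat.totient n : ℝ) / (n : ℝ) ^ 2) -
        cD * Real.log N| ≤ |C| * ell D ^ 2 := by
    intro N hN hN2
    have hNP : (N : ℝ) < bigP D := by
      have : (N : ℝ) ≤ ⌈hi⌉₊ := by exact_mod_cast hN2
      linarith
    have h := hA N (by exact_mod_cast hN) hNP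
    rw [Nat.ceil_natCast] at h
    refine h.trans ?_
    gcongr
    exact le_abs_self C
  -- Step 1
  have hstep1 := norm_lamAvg_sub_wsum_le c' χ j hcαℓ hℓ6 hlo0 (by linarith) hM0 (G := G)
    (fun n hn1 hn2 => (hG n (le_trans (Nat.le_ceil _) (by exact_mod_cast hn1))
      (by have : (n : ℝ) < ⌈hi⌉₊ := by exact_mod_cast hn2
          linarith)).2.1)
  -- the counting function at `⌈hi⌉`
  have hS : (∑ n ∈ Finset.Ico 1 ⌈hi⌉₊, ‖χ (n : ZMod D)‖ * (Nat.totient n : ℝ) / (n : ℝ) ^ 2) ≤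
      Real.log (bigP D) + |C| * ell D ^ 2 := by
    have hN : 1 ≤ ⌈hi⌉₊ := Nat.one_le_ceil_iff.mpr (by linarith)
    have h := hAw ⌈hi⌉₊ hN le_rfl
    have hlogle : cD * Real.log (⌈hi⌉₊ : ℝ) ≤ Real.log (bigP D) := by
      have h1 : Real.log (⌈hi⌉₊ : ℝ) ≤ Real.log (bigP D) :=
        Real.log_le_log (by exact_mod_cast (by omega : 0 < ⌈hi⌉₊)) (by linarith)
      have h2 : 0 ≤ Real.log (⌈hi⌉₊ : ℝ) := Real.log_nonneg (by exact_mod_cast hN)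
      calc cD * Real.log (⌈hi⌉₊ : ℝ) ≤ 1 * Real.log (⌈hi⌉₊ : ℝ) :=
            mul_le_mul_of_nonneg_right hcD1 h2
        _ ≤ Real.log (bigP D) := by rw [one_mul]; exact h1
    have := (abs_le.mp h).2
    linarith
  -- Step 2: the Abel/Riemann/endpoint engine
  have hstep2 := norm_sum_weight_sub_integral_le
    (w := fun n => ‖χ (n : ZMod D)‖ * (Nat.totient n : ℝ) / (n : ℝ) ^ 2) (c := cD)
    (K := |C| * ell D ^ 2) (M := M) (L := M') (F := G) hlo hlh (by positivity) hM'0 hAw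
    (fun t ht => ((hG t ht.1 ht.2).1.continuousAt).continuousWithinAt)
    (fun t h1 h2 => (hG t h1 h2).2.1)
    (fun x y hx hxy hy => lip_of_deriv_bound hlo0 (fun t h1 h2 => ⟨(hG t h1 h2).1, (hG t h1 h2).2.2⟩)
      hx hxy hy)
  -- combine
  have hlogw : Real.log ((hi + 1) / lo) ≤ Real.log (bigP D) := by
    apply Real.log_le_log (div_pos (by linarith) hlo0)
    rw [div_le_iff₀ hlo0]
    nlinarith
  have hlogw0 : 0 ≤ Real.log ((hi + 1) / lo) :=
    Real.log_nonneg (by rw [le_div_iff₀ hlo0]; linarith)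
  have harith := rule_arith (M := M) (M' := M') (C := C) (lo := lo) hℓ6 hΛ (alpha_mul_ell hℓ0) hM0
    hM'0 hcD0 hcD1 hlo hlogw hlogw0 hS
  calc ‖lamAvg c' χ j lo hi (fun n => G n) - (cD : ℂ) * ∫ t in lo..hi, G t / t‖
      ≤ ‖lamAvg c' χ j lo hi (fun n => G n) -
            ∑ n ∈ Finset.Ico ⌈lo⌉₊ ⌈hi⌉₊,
              ((‖χ (n : ZMod D)‖ * (Nat.totient n : ℝ) / (n : ℝ) ^ 2 : ℝ) : ℂ) * G n‖ +
          ‖(∑ n ∈ Finset.Ico ⌈lo⌉₊ ⌈hi⌉₊,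
              ((‖χ (n : ZMod D)‖ * (Nat.totient n : ℝ) / (n : ℝ) ^ 2 : ℝ) : ℂ) * G n) -
            (cD : ℂ) * ∫ t in lo..hi, G t / t‖ := norm_sub_le_norm_sub_add_norm_sub _ _ _
    _ ≤ _ := add_le_add hstep1 hstep2
    _ ≤ (2 * |C| + 4 + 589680 * π * (1 + |C|)) * ell D ^ 2 * (M + M' * Real.log (bigP D)) :=
        harith

end Rule

end Literature.NumberTheory.LFunctions.Zhang2022.Typed.Sec10C
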